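import Summits.BirchSwinnertonDyer.Rank1Residual.O5.FlexNFCaseNKummerLawThreeProofs
import HarnessLib

/-!
# O5 — T30.6 v2, Case S over the CUSP: every `ℚ₃`-point `(x, y)`, `x ≡ y ≡ 0 (mod 3)`, `x ≠ 0`, of
# `y² + 3b·xy + 3ᵃA₃·y = x³` (`A₃ ≡ 1 (mod 3)`; `a = 1, b ≡ 2` or `a = 2, 3 ∣ b (mod 3)` = the `k = 1` cells of `cellS`)
# has `y ∈ (3ᵃA₃)^e·ℚ₃^{×3}` with `e ∈ {1, 2}`
(cell `b2b-bsdres`, team n1011, ROW T-FLEX-KUM file F-S2a; seat `b2b-bsdres-n1011-p18` GEN 15, idle rule; theorems only;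
 no typer / o5-r1 / pool file is edited)

HONEST FRAMING (cell `b2b-bsdres`, run/shared/lean/b2b/bsd-rank1-residual/, verbatim in every file): the
goal of the cell is to DELETE the COMBINATION-SHAPED residual classes of the Birch–Swinnerton-Dyer formula
for ALL analytic-rank `≤ 1` elliptic curves over `ℚ` — "full BSD formula for every rank `≤ 1` curve in
class `C`" assembled STRICTLY from published theorems — so that the rank-`≤ 1` remainder becomes exactly
the CONSTRUCTION-SHAPED classes, which are TYPED (missing-input `Prop`s), NOT attempted. This is not
"finishing BSD". Lane CLASS-CLOSURE / O5 (O5 OPEN): research route; census output (P-K19) is EVIDENCE,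
never a Literature fact; nothing is booked; no mark of `RESIDUAL-MAP.md` moves. This file: THEOREMS ONLY
(no definition, no named fact, no `@[conjecture]` node, no `sorry`; net named-fact debt `0`).  Closes NO pair
and moves NO mark; it is `3`-adic algebra about one cubic equation, read by the O5 lane (o5-r1 GEN 13, T30)
as the `φ̂`-Kummer image `δ(P) = y(P)·ℚ₃^{×3}` (Cohen–Pazuki Def. 1.3 / Prop. 2.2).

## What is proved (the descent half of conjunct 2 of `FlexNFCaseSKummerSignedLawThree`; assembled in F-S2b)
Valuation/residue DESCENT on `y·(y + 3bx + 3ᵃA₃) = x³` alone — no group law, no Néron model / component group, no Tate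
run (T30 §1's "`E = ⟨P₀⟩ + E⁰`" is not needed).  With `X, Y ∈ ℤ₃`, `X ≡ Y ≡ 0 (mod 3)`:
* `a = 1` (`lineS_one`): `X = 3X₁`, `Y = 3Y₁`, `Y₁² + 3bX₁Y₁ + A₃Y₁ = 3X₁³` forces `Ȳ₁ ∈ {0, −1}`; for `Ȳ₁ = 0`
  (`lineS_one_inner`): `Y = 9Y₂`, `Y₂·U = X₁³`, `U = 3Y₂ + 3bX₁ + A₃`, and `Ȳ₂ = X̄₁³ = X̄₁` gives
  `3Y₂ + 3bX₁ = 3(1 + b)X₁ + 9τ ≡ 0 (mod 9)` EXACTLY BECAUSE `b ≡ 2`, so `U ≡ A₃ (mod 9)`, `U·A₃² ≡ A₃³ ≡ 1 (mod 9)` is a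
  cube (`exists_eq_sq_mul_cube`, via F-N2's `exists_pow_three_eq_of_sq_eq_one`) and `Y = (3A₃)²·w³`; for `Ȳ₁ = −1` the
  negative `−P` is in the first case and `y(P)·y(−P) = −x³` gives `e = 1` (`exists_eq_mul_cube_of_neg`).
* `a = 2` (`lineS_two`): `Y = 3Y₁` with `Ȳ₁ = 0`, `Y = 9Y₂`, then `X̄₁ = 0`, `X = 9X₂`, `Y₂² + 3bX₂Y₂ + A₃Y₂ = 9X₂³`,
  `Ȳ₂ ∈ {0, −1}`; for `Ȳ₂ = 0` (`lineS_two_inner`): `Y = 81Y₄`, `Y₄·U = X₂³`, `U = 9Y₄ + 3bX₂ + A₃ ≡ A₃ (mod 9)` EXACTLY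
  BECAUSE `3 ∣ b`, so `Y = (9A₃)²·w³`; `Ȳ₂ = −1` by the `−P` transfer (`e = 1`).
Toolkit additions (ns `…FlexNormalForm.KummerResidue`): `zmod3_points_S` (points of `ȳ² = x̄³` over `𝔽₃`), `zmod3_sq_add_self`,
`zmod3_cube`, `exists_eq_add_three_mul'`, `cancel_three_pow`, and the two `ℤ/9` checks `zmod9_key_one/two` used in F-S2b.
References: H. Cohen, F. Pazuki, Acta Arith. 140 (2009), Def. 1.3 / Prop. 2.2 [CohenPazuki2009ThreeDescent]; S. Gajović,
L. Radičević, M. Verzobio (2025), Thm. 55 [GajovicRadicevicVerzobio2025]; o5-r1 GEN 13 `T30-FLAT-KUMMER-NORMAL-FORM.md` §1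
(T30.6/T30.7; census P-K19 kit j142073 = EVIDENCE).
-/

noncomputable section

open Padic

namespace Summit.BirchSwinnertonDyer.Rank1Residual.O5.FlexNormalForm

namespace KummerResidue

/-- The affine points of `ȳ² = x̄³` over `𝔽₃` (the reduction of a Case-S flex normal form, cusp `(0, 0)`):
the cusp and `(1, ±1)`. [folklore] -/
theorem zmod3_points_S : ∀ x y : ZMod 3, y ^ 2 = x ^ 3 → (x = 0 ∧ y = 0) ∨ (x = 1 ∧ (y = 1 ∨ y = -1)) := by
  decide

/-- `t² + t = 0 → t ∈ {0, −1}` in `𝔽₃`. [folklore] -/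
theorem zmod3_sq_add_self : ∀ t : ZMod 3, t ^ 2 + t = 0 → t = 0 ∨ t = -1 := by decide

/-- `t³ = t` in `𝔽₃`. [folklore] -/
theorem zmod3_cube : ∀ t : ZMod 3, t ^ 3 = t := by decide

/-- Residue lift with a general base: `A ≡ B (mod 3) ⇒ A = B + 3τ`. [folklore] -/
theorem exists_eq_add_three_mul' {A B : ℤ_[3]} (h : PadicInt.toZMod A = PadicInt.toZMod B) :
    ∃ τ : ℤ_[3], A = B + 3 * τ := by
  have h0 : PadicInt.toZMod (A - B) = 0 := by rw [map_sub, h, sub_self]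
  obtain ⟨τ, hτ⟩ := (toZMod_eq_zero_iff_dvd _).1 h0
  exact ⟨τ, by linear_combination hτ⟩

/-- Cancelling a power of `3` in the domain `ℤ₃`. [folklore] -/
theorem cancel_three_pow {A B : ℤ_[3]} (n : ℕ) (h : (3 : ℤ_[3]) ^ n * A = (3 : ℤ_[3]) ^ n * B) : A = B :=
  mul_left_cancel₀ (pow_ne_zero n (by norm_num)) h

/-- The `ℤ/9` check behind the `(1, ±1)` residue class, `a = 1`, `b ≡ 2 (mod 3)` (`3b̄ = 6`), `A₃ ≡ 1 (mod 3)`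
(`3Ā₃ = 3`): the equation forces `(1 + 3η̄)² = 1`. [folklore] -/
theorem zmod9_key_one : ∀ η b A : ZMod 9, 3 * b = 6 → 3 * A = 3 →
    (1 + 3 * η) ^ 2 + 3 * b * (1 + 3 * η) + 3 * A * (1 + 3 * η) - 1 = 0 → (1 + 3 * η) ^ 2 = 1 := by decide

/-- The same check for `a = 2`, `b ≡ 0 (mod 3)` (`3b̄ = 0`). [folklore] -/
theorem zmod9_key_two : ∀ η b A : ZMod 9, 3 * b = 0 →
    (1 + 3 * η) ^ 2 + 3 * b * (1 + 3 * η) + 9 * A * (1 + 3 * η) - 1 = 0 → (1 + 3 * η) ^ 2 = 1 := by decide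

end KummerResidue

open KummerResidue

section CaseS

variable (b A₃ : ℤ) {X Y : ℤ_[3]}

/-- `A₃ ≡ 1 (mod 3)` in `ZMod 3`. [folklore] -/
private theorem intCast_A₃_eq_one_S (hA : A₃ % 3 = 1) : ((A₃ : ℤ) : ZMod 3) = 1 := by
  simpa using (ZMod.intCast_eq_intCast_iff' A₃ 1 3).2 (by omega)

/-- **The common last step over the cusp.**  If `Y₀·U = X₀³` in `ℤ₃` with `U ≡ A₃ (mod 9)` and `A₃ ≡ 1 (mod 3)`, then
`U·A₃² ≡ A₃³ ≡ 1 (mod 9)` is a cube, so `Y₀ = A₃²·w³`. [folklore] -/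
theorem exists_eq_sq_mul_cube (hA : A₃ % 3 = 1) {X₀ Y₀ U : ℤ_[3]} (hYU : Y₀ * U = X₀ ^ 3)
    (hU : PadicInt.toZModPow 2 U = PadicInt.toZModPow 2 (A₃ : ℤ_[3])) :
    ∃ w : ℚ_[3], (Y₀ : ℚ_[3]) = ((A₃ : ℤ) : ℚ_[3]) ^ 2 * w ^ 3 := by
  obtain ⟨j, hj⟩ : ∃ j : ℤ, A₃ = 3 * j + 1 := ⟨A₃ / 3, by omega⟩
  have h9 : (9 : ZMod (3 ^ 2)) = 0 := by decide
  have hUA : PadicInt.toZModPow 2 (U * (A₃ : ℤ_[3]) ^ 2) = 1 := by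
    rw [map_mul, hU, ← map_mul]
    have e : (A₃ : ℤ_[3]) * (A₃ : ℤ_[3]) ^ 2 = 1 + 9 * ((j : ℤ_[3]) * (3 * j ^ 2 + 3 * j + 1)) := by
      rw [show (A₃ : ℤ_[3]) = 3 * (j : ℤ_[3]) + 1 by exact_mod_cast hj]; ring
    rw [e, map_add, map_one, map_mul, map_ofNat, h9, zero_mul, add_zero]
  obtain ⟨w₀, hw₀⟩ := exists_pow_three_eq_of_sq_eq_one (u := U * (A₃ : ℤ_[3]) ^ 2) (by rw [hUA, one_pow])
  have hw₀0 : w₀ ≠ 0 := by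
    rintro rfl
    have h0 : U * (A₃ : ℤ_[3]) ^ 2 = 0 := PadicInt.coe_eq_zero.1 (by rw [hw₀]; ring)
    rw [h0, map_zero] at hUA
    exact absurd hUA (by decide)
  have hq : (Y₀ : ℚ_[3]) * (U : ℚ_[3]) = (X₀ : ℚ_[3]) ^ 3 := by
    have := congrArg (fun z : ℤ_[3] => (z : ℚ_[3])) hYU; push_cast at this; exact this
  push_cast at hw₀
  refine ⟨(X₀ : ℚ_[3]) / w₀, ?_⟩
  rw [div_pow, ← mul_div_assoc, eq_div_iff (pow_ne_zero _ hw₀0)]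
  linear_combination ((A₃ : ℤ) : ℚ_[3]) ^ 2 * hq - (Y₀ : ℚ_[3]) * hw₀

/-- **The `−P` transfer.**  If `Y·Y′ = −X³`, `X ≠ 0` and `Y′ = c²·w³` then `Y = c·w′³`. [folklore] -/
theorem exists_eq_mul_cube_of_neg {c X Y Y' w : ℚ_[3]} (hc : c ≠ 0) (hX : X ≠ 0) (hprod : Y * Y' = -X ^ 3)
    (hY' : Y' = c ^ 2 * w ^ 3) : ∃ w' : ℚ_[3], Y = c ^ 1 * w' ^ 3 := by
  have hw : w ≠ 0 := by
    rintro rfl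
    refine hX (pow_eq_zero_iff three_ne_zero |>.1 ?_)
    rw [hY'] at hprod; linear_combination hprod
  refine ⟨-X / (c * w), ?_⟩
  rw [div_pow, ← mul_div_assoc, eq_div_iff (pow_ne_zero _ (mul_ne_zero hc hw))]
  linear_combination c * hprod - c * Y * hY'

/-! ### The residue class `(0, 0)` (points over the cusp, `P₀` among them): `y ∈ (3ᵃA₃)^{1,2}·ℚ₃^{×3}` -/

/-- **`a = 1`, inner case.** `b ≡ 2 (mod 3)`, `A₃ ≡ 1 (mod 3)`; `X = 3X₁`, `Y = 3Y₁` with `Y₁ ≡ 0 (mod 3)`: then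
`Y = 9Y₂`, `Y₂·U = X₁³` with `U = 3Y₂ + 3bX₁ + A₃`, and `Ȳ₂ = X̄₁³ = X̄₁` makes `3Y₂ + 3bX₁ = 3(1 + b)X₁ ≡ 0 (mod 9)`,
so `U ≡ A₃ (mod 9)` and `Y = (3A₃)²·w³`. [folklore] -/
theorem lineS_one_inner (hb : b % 3 = 2) (hA : A₃ % 3 = 1) {X₁ Y₁ : ℤ_[3]}
    (hE : Y ^ 2 + 3 * (b : ℤ_[3]) * X * Y + 3 ^ 1 * (A₃ : ℤ_[3]) * Y = X ^ 3)
    (hX : X = 3 * X₁) (hY : Y = 3 * Y₁) (hy₁ : PadicInt.toZMod Y₁ = 0) :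
    ∃ w : ℚ_[3], (Y : ℚ_[3]) = ((3 : ℚ_[3]) ^ 1 * (A₃ : ℚ_[3])) ^ 2 * w ^ 3 := by
  have h30 : (3 : ZMod 3) = 0 := by decide
  have h9 : (9 : ZMod (3 ^ 2)) = 0 := by decide
  have hA3 := intCast_A₃_eq_one_S A₃ hA
  obtain ⟨Y₂, hY₂⟩ := exists_eq_add_three_mul (X := Y₁) (c := 0) (by rw [hy₁]; push_cast; rfl)
  rw [Int.cast_zero, zero_add] at hY₂
  have hE2 : 3 * Y₂ ^ 2 + 3 * (b : ℤ_[3]) * X₁ * Y₂ + (A₃ : ℤ_[3]) * Y₂ = X₁ ^ 3 := by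
    refine cancel_three_pow 3 ?_
    rw [hX, hY, hY₂] at hE; linear_combination hE
  set U : ℤ_[3] := 3 * Y₂ + 3 * (b : ℤ_[3]) * X₁ + (A₃ : ℤ_[3]) with hU
  have hYU : Y₂ * U = X₁ ^ 3 := by rw [hU]; linear_combination hE2
  have hres : PadicInt.toZMod Y₂ = PadicInt.toZMod X₁ := by
    have := congrArg PadicInt.toZMod hE2
    simp only [map_add, map_mul, map_pow, map_ofNat, map_intCast, h30, hA3, zero_mul, zero_add, one_mul] at this
    rw [this, zmod3_cube]
  obtain ⟨τ, hτ⟩ := exists_eq_add_three_mul' hres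
  obtain ⟨k, hk⟩ : ∃ k : ℤ, b = 3 * k + 2 := ⟨b / 3, by omega⟩
  have hU9 : PadicInt.toZModPow 2 U = PadicInt.toZModPow 2 (A₃ : ℤ_[3]) := by
    have e : U = 9 * (X₁ + τ + (k : ℤ_[3]) * X₁) + (A₃ : ℤ_[3]) := by
      rw [hU, hτ, show (b : ℤ_[3]) = 3 * (k : ℤ_[3]) + 2 by exact_mod_cast hk]; ring
    rw [e, map_add, map_mul, map_ofNat, h9, zero_mul, zero_add]
  obtain ⟨w, hw⟩ := exists_eq_sq_mul_cube A₃ hA hYU hU9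
  refine ⟨w, ?_⟩
  have h3c : ((3 : ℤ_[3]) : ℚ_[3]) = 3 := by exact_mod_cast PadicInt.coe_natCast (p := 3) 3
  have hYc : (Y : ℚ_[3]) = 9 * (Y₂ : ℚ_[3]) := by
    rw [hY, hY₂]; push_cast; rw [h3c]; ring
  rw [hYc, hw]; ring

/-- **`a = 1` over the cusp.** `b ≡ 2 (mod 3)`, `A₃ ≡ 1 (mod 3)`: every `ℤ₃`-point with `X ≡ Y ≡ 0 (mod 3)`, `X ≠ 0`, of
`Y² + 3b·XY + 3A₃Y = X³` has `Y ∈ (3A₃)^e·ℚ₃^{×3}` with `e ∈ {1, 2}` (`Ȳ₁ ∈ {0, −1}`; the `−1` branch is the `−P` of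
the `0` branch). [folklore] -/
theorem lineS_one (hb : b % 3 = 2) (hA : A₃ % 3 = 1)
    (hE : Y ^ 2 + 3 * (b : ℤ_[3]) * X * Y + 3 ^ 1 * (A₃ : ℤ_[3]) * Y = X ^ 3) (hX0 : X ≠ 0)
    (hx : PadicInt.toZMod X = 0) (hy : PadicInt.toZMod Y = 0) :
    ∃ (e : ℕ) (w : ℚ_[3]), (Y : ℚ_[3]) = ((3 : ℚ_[3]) ^ 1 * (A₃ : ℚ_[3])) ^ e * w ^ 3 := by
  have h30 : (3 : ZMod 3) = 0 := by decide
  have hA3 := intCast_A₃_eq_one_S A₃ hA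
  obtain ⟨X₁, hX₁⟩ := exists_eq_add_three_mul (X := X) (c := 0) (by rw [hx]; push_cast; rfl)
  obtain ⟨Y₁, hY₁⟩ := exists_eq_add_three_mul (X := Y) (c := 0) (by rw [hy]; push_cast; rfl)
  rw [Int.cast_zero, zero_add] at hX₁ hY₁
  have hE1 : Y₁ ^ 2 + 3 * (b : ℤ_[3]) * X₁ * Y₁ + (A₃ : ℤ_[3]) * Y₁ = 3 * X₁ ^ 3 := by
    refine cancel_three_pow 2 ?_
    rw [hX₁, hY₁] at hE; linear_combination hE
  have hres : (PadicInt.toZMod Y₁) ^ 2 + PadicInt.toZMod Y₁ = 0 := by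
    have := congrArg PadicInt.toZMod hE1
    simpa only [map_add, map_mul, map_pow, map_ofNat, map_intCast, h30, hA3, zero_mul, add_zero, one_mul] using this
  rcases zmod3_sq_add_self _ hres with h0 | h1
  · obtain ⟨w, hw⟩ := lineS_one_inner b A₃ hb hA hE hX₁ hY₁ h0
    exact ⟨2, w, hw⟩
  · set Y' : ℤ_[3] := -Y - 3 * (b : ℤ_[3]) * X - 3 ^ 1 * (A₃ : ℤ_[3]) with hY'
    have hE' : Y' ^ 2 + 3 * (b : ℤ_[3]) * X * Y' + 3 ^ 1 * (A₃ : ℤ_[3]) * Y' = X ^ 3 := by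
      rw [hY']; linear_combination hE
    have hY'₁ : Y' = 3 * (-Y₁ - 3 * (b : ℤ_[3]) * X₁ - (A₃ : ℤ_[3])) := by rw [hY', hX₁, hY₁]; ring
    have hres' : PadicInt.toZMod (-Y₁ - 3 * (b : ℤ_[3]) * X₁ - (A₃ : ℤ_[3])) = 0 := by
      simp only [map_sub, map_neg, map_mul, map_ofNat, map_intCast, h1, h30, hA3, zero_mul, sub_zero, neg_neg,
        sub_self]
    obtain ⟨w, hw⟩ := lineS_one_inner b A₃ hb hA hE' hX₁ hY'₁ hres'
    have hprod : (Y : ℚ_[3]) * (Y' : ℚ_[3]) = -(X : ℚ_[3]) ^ 3 := by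
      have hZ : Y * Y' = -X ^ 3 := by rw [hY']; linear_combination -hE
      have := congrArg (fun z : ℤ_[3] => (z : ℚ_[3])) hZ; push_cast at this; exact this
    have hc : (3 : ℚ_[3]) ^ 1 * (A₃ : ℚ_[3]) ≠ 0 :=
      mul_ne_zero (by norm_num) (by exact_mod_cast (show A₃ ≠ 0 by omega))
    obtain ⟨w', hw'⟩ := exists_eq_mul_cube_of_neg hc (PadicInt.coe_ne_zero.2 hX0) hprod hw
    exact ⟨1, w', hw'⟩

/-- **`a = 2`, inner case.** `3 ∣ b`, `A₃ ≡ 1 (mod 3)`; `X = 9X₂`, `Y = 9Y₂` with `Y₂ ≡ 0 (mod 3)`: then `Y = 81Y₄`,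
`Y₄·U = X₂³` with `U = 9Y₄ + 3bX₂ + A₃ ≡ A₃ (mod 9)`, so `Y = (9A₃)²·w³`. [folklore] -/
theorem lineS_two_inner (hb : b % 3 = 0) (hA : A₃ % 3 = 1) {X₂ Y₂ : ℤ_[3]}
    (hE : Y ^ 2 + 3 * (b : ℤ_[3]) * X * Y + 3 ^ 2 * (A₃ : ℤ_[3]) * Y = X ^ 3)
    (hX : X = 9 * X₂) (hY : Y = 9 * Y₂) (hy₂ : PadicInt.toZMod Y₂ = 0) :
    ∃ w : ℚ_[3], (Y : ℚ_[3]) = ((3 : ℚ_[3]) ^ 2 * (A₃ : ℚ_[3])) ^ 2 * w ^ 3 := by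
  have h30 : (3 : ZMod 3) = 0 := by decide
  have h9 : (9 : ZMod (3 ^ 2)) = 0 := by decide
  have hA3 := intCast_A₃_eq_one_S A₃ hA
  obtain ⟨Y₃, hY₃⟩ := exists_eq_add_three_mul (X := Y₂) (c := 0) (by rw [hy₂]; push_cast; rfl)
  rw [Int.cast_zero, zero_add] at hY₃
  -- `3Y₃² + 3bX₂Y₃ + A₃Y₃ = 3X₂³`
  have hE3 : 3 * Y₃ ^ 2 + 3 * (b : ℤ_[3]) * X₂ * Y₃ + (A₃ : ℤ_[3]) * Y₃ = 3 * X₂ ^ 3 := by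
    refine cancel_three_pow 5 ?_
    rw [hX, hY, hY₃] at hE; linear_combination hE
  have hy₃ : PadicInt.toZMod Y₃ = 0 := by
    have := congrArg PadicInt.toZMod hE3
    simpa only [map_add, map_mul, map_pow, map_ofNat, map_intCast, h30, hA3, zero_mul, zero_add, one_mul] using this
  obtain ⟨Y₄, hY₄⟩ := exists_eq_add_three_mul (X := Y₃) (c := 0) (by rw [hy₃]; push_cast; rfl)
  rw [Int.cast_zero, zero_add] at hY₄
  -- `9Y₄² + 3bX₂Y₄ + A₃Y₄ = X₂³`
  have hE4 : 9 * Y₄ ^ 2 + 3 * (b : ℤ_[3]) * X₂ * Y₄ + (A₃ : ℤ_[3]) * Y₄ = X₂ ^ 3 := by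
    refine cancel_three_pow 1 ?_
    rw [hY₄] at hE3; linear_combination hE3
  set U : ℤ_[3] := 9 * Y₄ + 3 * (b : ℤ_[3]) * X₂ + (A₃ : ℤ_[3]) with hU
  have hYU : Y₄ * U = X₂ ^ 3 := by rw [hU]; linear_combination hE4
  obtain ⟨k, hk⟩ : ∃ k : ℤ, b = 3 * k := ⟨b / 3, by omega⟩
  have hU9 : PadicInt.toZModPow 2 U = PadicInt.toZModPow 2 (A₃ : ℤ_[3]) := by
    have e : U = 9 * (Y₄ + (k : ℤ_[3]) * X₂) + (A₃ : ℤ_[3]) := by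
      rw [hU, show (b : ℤ_[3]) = 3 * (k : ℤ_[3]) by exact_mod_cast hk]; ring
    rw [e, map_add, map_mul, map_ofNat, h9, zero_mul, zero_add]
  obtain ⟨w, hw⟩ := exists_eq_sq_mul_cube A₃ hA hYU hU9
  refine ⟨w, ?_⟩
  have h3c : ((3 : ℤ_[3]) : ℚ_[3]) = 3 := by exact_mod_cast PadicInt.coe_natCast (p := 3) 3
  have h9c : ((9 : ℤ_[3]) : ℚ_[3]) = 9 := by exact_mod_cast PadicInt.coe_natCast (p := 3) 9
  have hYc : (Y : ℚ_[3]) = 81 * (Y₄ : ℚ_[3]) := by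
    rw [hY, hY₃, hY₄]; push_cast; rw [h3c, h9c]; ring
  rw [hYc, hw]; ring

/-- **`a = 2` over the cusp.** `3 ∣ b`, `A₃ ≡ 1 (mod 3)`: every `ℤ₃`-point with `X ≡ Y ≡ 0 (mod 3)`, `X ≠ 0`, of
`Y² + 3b·XY + 9A₃Y = X³` has `Y ∈ (9A₃)^e·ℚ₃^{×3}`, `e ∈ {1, 2}` (descent `Y = 3Y₁`, `Ȳ₁ = 0`, `Y = 9Y₂`, `X̄₁ = 0`,
`X = 9X₂`, then `Ȳ₂ ∈ {0, −1}` and the `−P` trick). [folklore] -/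
theorem lineS_two (hb : b % 3 = 0) (hA : A₃ % 3 = 1)
    (hE : Y ^ 2 + 3 * (b : ℤ_[3]) * X * Y + 3 ^ 2 * (A₃ : ℤ_[3]) * Y = X ^ 3) (hX0 : X ≠ 0)
    (hx : PadicInt.toZMod X = 0) (hy : PadicInt.toZMod Y = 0) :
    ∃ (e : ℕ) (w : ℚ_[3]), (Y : ℚ_[3]) = ((3 : ℚ_[3]) ^ 2 * (A₃ : ℚ_[3])) ^ e * w ^ 3 := by
  have h30 : (3 : ZMod 3) = 0 := by decide
  have hA3 := intCast_A₃_eq_one_S A₃ hA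
  obtain ⟨X₁, hX₁⟩ := exists_eq_add_three_mul (X := X) (c := 0) (by rw [hx]; push_cast; rfl)
  obtain ⟨Y₁, hY₁⟩ := exists_eq_add_three_mul (X := Y) (c := 0) (by rw [hy]; push_cast; rfl)
  rw [Int.cast_zero, zero_add] at hX₁ hY₁
  -- `Y₁² + 3bX₁Y₁ + 3A₃Y₁ = 3X₁³`, so `Ȳ₁ = 0`
  have hE1 : Y₁ ^ 2 + 3 * (b : ℤ_[3]) * X₁ * Y₁ + 3 * (A₃ : ℤ_[3]) * Y₁ = 3 * X₁ ^ 3 := by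
    refine cancel_three_pow 2 ?_
    rw [hX₁, hY₁] at hE; linear_combination hE
  have hy₁ : PadicInt.toZMod Y₁ = 0 := by
    have := congrArg PadicInt.toZMod hE1
    simp only [map_add, map_mul, map_pow, map_ofNat, map_intCast, h30, zero_mul, add_zero] at this
    exact zmod3_sq_eq_zero _ this
  obtain ⟨Y₂, hY₂⟩ := exists_eq_add_three_mul (X := Y₁) (c := 0) (by rw [hy₁]; push_cast; rfl)
  rw [Int.cast_zero, zero_add] at hY₂
  -- `3Y₂² + 3bX₁Y₂ + 3A₃Y₂ = X₁³`, so `X̄₁ = 0`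
  have hE1' : 3 * Y₂ ^ 2 + 3 * (b : ℤ_[3]) * X₁ * Y₂ + 3 * (A₃ : ℤ_[3]) * Y₂ = X₁ ^ 3 := by
    refine cancel_three_pow 1 ?_
    rw [hY₂] at hE1; linear_combination hE1
  have hx₁ : PadicInt.toZMod X₁ = 0 := by
    have := congrArg PadicInt.toZMod hE1'
    simp only [map_add, map_mul, map_pow, map_ofNat, map_intCast, h30, zero_mul, zero_add] at this
    have h3 : (PadicInt.toZMod X₁) ^ 3 = 0 := this.symm
    rw [zmod3_cube] at h3
    exact h3
  obtain ⟨X₂, hX₂⟩ := exists_eq_add_three_mul (X := X₁) (c := 0) (by rw [hx₁]; push_cast; rfl)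
  rw [Int.cast_zero, zero_add] at hX₂
  have hX9 : X = 9 * X₂ := by rw [hX₁, hX₂]; ring
  have hY9 : Y = 9 * Y₂ := by rw [hY₁, hY₂]; ring
  -- `Y₂² + 3bX₂Y₂ + A₃Y₂ = 9X₂³`, so `Ȳ₂ ∈ {0, −1}`
  have hE2 : Y₂ ^ 2 + 3 * (b : ℤ_[3]) * X₂ * Y₂ + (A₃ : ℤ_[3]) * Y₂ = 9 * X₂ ^ 3 := by
    refine cancel_three_pow 4 ?_
    rw [hX9, hY9] at hE; linear_combination hE
  have hres : (PadicInt.toZMod Y₂) ^ 2 + PadicInt.toZMod Y₂ = 0 := by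
    have := congrArg PadicInt.toZMod hE2
    simpa only [map_add, map_mul, map_pow, map_ofNat, map_intCast, h30, hA3, zero_mul, add_zero, one_mul,
      show (9 : ZMod 3) = 0 by decide] using this
  rcases zmod3_sq_add_self _ hres with h0 | h1
  · obtain ⟨w, hw⟩ := lineS_two_inner b A₃ hb hA hE hX9 hY9 h0
    exact ⟨2, w, hw⟩
  · set Y' : ℤ_[3] := -Y - 3 * (b : ℤ_[3]) * X - 3 ^ 2 * (A₃ : ℤ_[3]) with hY'
    have hE' : Y' ^ 2 + 3 * (b : ℤ_[3]) * X * Y' + 3 ^ 2 * (A₃ : ℤ_[3]) * Y' = X ^ 3 := by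
      rw [hY']; linear_combination hE
    have hY'₂ : Y' = 9 * (-Y₂ - 3 * (b : ℤ_[3]) * X₂ - (A₃ : ℤ_[3])) := by rw [hY', hX9, hY9]; ring
    have hres' : PadicInt.toZMod (-Y₂ - 3 * (b : ℤ_[3]) * X₂ - (A₃ : ℤ_[3])) = 0 := by
      simp only [map_sub, map_neg, map_mul, map_ofNat, map_intCast, h1, h30, hA3, zero_mul, sub_zero, neg_neg,
        sub_self]
    obtain ⟨w, hw⟩ := lineS_two_inner b A₃ hb hA hE' hX9 hY'₂ hres'
    have hprod : (Y : ℚ_[3]) * (Y' : ℚ_[3]) = -(X : ℚ_[3]) ^ 3 := by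
      have hZ : Y * Y' = -X ^ 3 := by rw [hY']; linear_combination -hE
      have := congrArg (fun z : ℤ_[3] => (z : ℚ_[3])) hZ; push_cast at this; exact this
    have hc : (3 : ℚ_[3]) ^ 2 * (A₃ : ℚ_[3]) ≠ 0 :=
      mul_ne_zero (by norm_num) (by exact_mod_cast (show A₃ ≠ 0 by omega))
    obtain ⟨w', hw'⟩ := exists_eq_mul_cube_of_neg hc (PadicInt.coe_ne_zero.2 hX0) hprod hw
    exact ⟨1, w', hw'⟩

end CaseS

end Summit.BirchSwinnertonDyer.Rank1Residual.O5.FlexNormalForm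

end
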